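import Literature.MathematicalPhysics.QuantumFieldTheory.Balaban1983to89.Node00.WilsonActionSecondVariationExpansion

/-!
# NODE 00 — THE SECOND VARIATION OF THE WILSON ACTION (5), III: NEAR A FLAT BACKGROUND — the «first order in A₀» comparison of [B16] p.357 ∕ the smallness of `Δ′ = Δ − D*D`
# of [B9] (3.10), TWO-SIDED: `|d²∕dt² A(U·e^{tX})∣₀ − d²∕dt² A(1·e^{tX})∣₀| ≤ 4δ·Σ_p (Σ_k‖X_{b_k}‖)²` when every bond variable of `U` is within `δ` of `1`; and the flat value itself,
# `d²∕dt² A(e^{tX})∣₀ = (1∕N)·Σ_p Re Tr(σ⁰_p⋆σ⁰_p)`, `σ⁰_p = 𝕏₁ + 𝕏₂ − 𝕏₃ − 𝕏₄` the plain lattice curl of `X` around `∂p`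

Cell `pub-ymgap`, WIDTH SEAT `pub-ymgap-dag-n12-w2` generation 0 (HUMAN RULING D-0149 ∕ director-ym №197; DAG node N12 = [B15]; W-SEAT-START-LIST v2 §N12 ITEM 2 = U2a, fourth file;
INBOX INTENT-4).  Addressed to the U2 lane's located letter (b) (dag-n12-w4 g0 LOCATED-1 ∕ dag-n12-c g16 «two-sided or lower half?»): the part of [B16] p.357's «we expand the expressions
defining the quadratic form with respect to A₀, up to the first order in A₀ … The leading term in the expansion is the quadratic form with the background field identically equal to 1»
that lives at the level of the Wilson action — TWO-SIDED, with the explicit constant `4`.  CONSUMED BY NAME: this seat's p583639 ∕ p585069 (`hasDerivAt_deriv_wilsonAction4_expChart_inserted`,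
`secondVariation_expChart_of_plaqHol_eq_one`), `MatrixNorms.abs_nReTr_le_opNorm` (B7 (20)), Mathlib `CStarRing.norm_mul_mem_unitary`∕`norm_mem_unitary_mul`.
`--kind proof --supports stmt-QuantumFields-20542` (K1⁷; count-neutral).

PRINT.  [B9] = [Balaban1985BackgroundPropagators] p. 392 (3.10): «⟨A, ΔA⟩ = ⟨A, D*DA⟩ + ⟨A, Δ′A⟩ … We have written it this way because with our assumptions on the configuration U the
operator Δ′ will be a bounded, small operator, which will be treated as a small perturbation of D*D»; [B16] = [Balaban1989LargeFieldII] p. 357 (quoted above) and (1.7) p. 358.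
READING: «the configuration U is close to 1» is taken BOND-WISE in the operator norm (19), `‖U_b − 1‖ ≤ δ` — the form print reaches after its gauge transformation («we represent it on the
domain Z as exp iξA₀, with A₀ satisfying |A₀|, |∇A₀| < O(1)M⁵R_kε_k», p. 357); no gauge fixing is done here.

CONTENTS (theorems only; no `def`, no `instance`).
* §1 `norm_star_sub_one`, `norm_mul_sub_one_le` (deviations add under products of unitaries), ★ `norm_unitary_word_sub_le`(′) (`‖u₁Yu₂Zu₃ − YZ‖ ≤ (Σ‖u_i − 1‖)·‖Y‖‖Z‖`),
  `norm_unitary_word_le`, `norm_inserted_le` (`‖inserted‖ ≤ (Σ_k‖X_k‖)²`), ★★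
  `norm_inserted_sub_flat_le` — PER PLAQUETTE the (3.2) inserted second-variation matrix at `(A,B,C,D)` is within `4δ(Σ_k‖X_k‖)²` of its value at `A = B = C = D = 1`.
* §2 on the lattice: `coe_one_apply_SU` (bookkeeping), ★★ `abs_deriv_deriv_wilsonAction4_expChart_le` (`|Q_U(X)| ≤ Σ_p s_p²` for every `U`: `Δ(U)` bounded), ★★★ `abs_deriv_deriv_wilsonAction4_expChart_sub_flat_le_local` (a deviation budget `δ p` per plaquette; plaquettes off the
  support of `X` are free) and `abs_deriv_deriv_wilsonAction4_expChart_sub_flat_le` — `|Q_U(X) − Q_1(X)| ≤ 4δ·Σ_p (Σ_k‖X_{b_k}‖)²` for the second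
  derivatives `Q_U(X) = deriv (deriv (A ∘ (U·e^{·X}))) 0`; ★ `deriv_deriv_wilsonAction4_expChart_one` — the flat value `Q_1(X) = (1∕N)Σ_p Re Tr(σ⁰_p⋆σ⁰_p)`, and `…_eq_norm_sq`: `= (1∕N)Σ_p‖σ⁰_p‖²` in
  the Hilbert–Schmidt norm (17) of `𝔰𝔲(N)` (`norm_sq_lieSU_eq_re_trace`) («∂*∂ in the Abelian case»).

HONEST FRAMING: an elementary operator-norm estimate and bookkeeping about the tree's own action functional; the localisation∕decay letter (c) of the U2 lane and the linearised
minimiser (U2b) are NOT here; nothing of Bałaban's estimates beyond this explicit inequality is asserted; count-neutral; N12 NOT discharged (5∕27 unmoved); finite 𝕋⁴ at fixed ε, Bałaban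
AS PRINTED with locators; R4 closes the conditional rung `BalabanLadder.UV` only — NOT continuum ∕ ℝ⁴ ∕ OS ∕ mass gap ∕ Clay.  No `sorry`, no `def`, no `instance`.
-/

noncomputable section

namespace Literature.MathematicalPhysics.QuantumFieldTheory.Balaban1983to89.Node00

open T4AdjointCovarianceUnitary (lieSU)
open scoped Matrix.Norms.L2Operator

/-! ## §1  Unitary bookkeeping in the operator norm: deviations from `1` add up under products, and conjugating factors cost their deviation -/

section UnitaryDeviation

variable {N : ℕ}

/-- `‖u⋆ − 1‖ = ‖u − 1‖`. [cite: Balaban1985Averaging, (19) p.21 (bookkeeping)] -/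
theorem norm_star_sub_one (u : Matrix (Fin N) (Fin N) ℂ) : ‖star u - 1‖ = ‖u - 1‖ := by
  have h : star u - 1 = star (u - 1) := by rw [star_sub, star_one]
  rw [h, norm_star]

/-- Deviations add under products of unitaries: `‖uv − 1‖ ≤ ‖u − 1‖ + ‖v − 1‖` (`uv − 1 = u(v − 1) + (u − 1)`, `‖u(v−1)‖ = ‖v−1‖`).
[cite: Balaban1985Averaging, (19)–(20) p.21 (bookkeeping)] -/
theorem norm_mul_sub_one_le {u : Matrix (Fin N) (Fin N) ℂ} (hu : u ∈ unitary (Matrix (Fin N) (Fin N) ℂ)) (v : Matrix (Fin N) (Fin N) ℂ) :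
    ‖u * v - 1‖ ≤ ‖u - 1‖ + ‖v - 1‖ := by
  have h : u * v - 1 = u * (v - 1) + (u - 1) := by noncomm_ring
  rw [h, add_comm ‖u - 1‖]
  exact (norm_add_le _ _).trans (by rw [CStarRing.norm_mem_unitary_mul _ hu])

/-- ★ **CONJUGATING UNITARY FACTORS COST THEIR DEVIATION**: for unitaries `u₁, u₂, u₃`, `‖u₁Yu₂Zu₃ − YZ‖ ≤ (‖u₁−1‖ + ‖u₂−1‖ + ‖u₃−1‖)·‖Y‖·‖Z‖` — the shape of every word of the
(3.2) inserted second variation against its flat (`U ≡ 1`) value. [cite: Balaban1985BackgroundPropagators, (3.10) p.392 («Δ′ will be a bounded, small operator»); Balaban1989LargeFieldII, p.357] -/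
theorem norm_unitary_word_sub_le (u₁ : Matrix (Fin N) (Fin N) ℂ) {u₂ u₃ : Matrix (Fin N) (Fin N) ℂ} (h₂ : u₂ ∈ unitary (Matrix (Fin N) (Fin N) ℂ))
    (h₃ : u₃ ∈ unitary (Matrix (Fin N) (Fin N) ℂ)) (Y Z : Matrix (Fin N) (Fin N) ℂ) :
    ‖u₁ * Y * u₂ * Z * u₃ - Y * Z‖ ≤ (‖u₁ - 1‖ + ‖u₂ - 1‖ + ‖u₃ - 1‖) * ‖Y‖ * ‖Z‖ := by
  have h : u₁ * Y * u₂ * Z * u₃ - Y * Z = (u₁ - 1) * Y * (u₂ * Z) * u₃ + Y * (u₂ - 1) * Z * u₃ + Y * Z * (u₃ - 1) := by noncomm_ring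
  rw [h]
  have e1 : ‖(u₁ - 1) * Y * (u₂ * Z) * u₃‖ ≤ ‖u₁ - 1‖ * ‖Y‖ * ‖Z‖ := by
    rw [CStarRing.norm_mul_mem_unitary _ h₃]
    calc ‖(u₁ - 1) * Y * (u₂ * Z)‖ ≤ ‖(u₁ - 1) * Y‖ * ‖u₂ * Z‖ := norm_mul_le _ _
      _ ≤ ‖u₁ - 1‖ * ‖Y‖ * ‖Z‖ := by rw [CStarRing.norm_mem_unitary_mul _ h₂]; exact mul_le_mul_of_nonneg_right (norm_mul_le _ _) (norm_nonneg _)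
  have e2 : ‖Y * (u₂ - 1) * Z * u₃‖ ≤ ‖u₂ - 1‖ * ‖Y‖ * ‖Z‖ := by
    rw [CStarRing.norm_mul_mem_unitary _ h₃]
    calc ‖Y * (u₂ - 1) * Z‖ ≤ ‖Y * (u₂ - 1)‖ * ‖Z‖ := norm_mul_le _ _
      _ ≤ ‖Y‖ * ‖u₂ - 1‖ * ‖Z‖ := mul_le_mul_of_nonneg_right (norm_mul_le _ _) (norm_nonneg _)
      _ = ‖u₂ - 1‖ * ‖Y‖ * ‖Z‖ := by ring
  have e3 : ‖Y * Z * (u₃ - 1)‖ ≤ ‖u₃ - 1‖ * ‖Y‖ * ‖Z‖ := by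
    calc ‖Y * Z * (u₃ - 1)‖ ≤ ‖Y * Z‖ * ‖u₃ - 1‖ := norm_mul_le _ _
      _ ≤ ‖Y‖ * ‖Z‖ * ‖u₃ - 1‖ := mul_le_mul_of_nonneg_right (norm_mul_le _ _) (norm_nonneg _)
      _ = ‖u₃ - 1‖ * ‖Y‖ * ‖Z‖ := by ring
  calc ‖(u₁ - 1) * Y * (u₂ * Z) * u₃ + Y * (u₂ - 1) * Z * u₃ + Y * Z * (u₃ - 1)‖
      ≤ ‖(u₁ - 1) * Y * (u₂ * Z) * u₃‖ + ‖Y * (u₂ - 1) * Z * u₃‖ + ‖Y * Z * (u₃ - 1)‖ := norm_add₃_le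
    _ ≤ ‖u₁ - 1‖ * ‖Y‖ * ‖Z‖ + ‖u₂ - 1‖ * ‖Y‖ * ‖Z‖ + ‖u₃ - 1‖ * ‖Y‖ * ‖Z‖ := add_le_add_three e1 e2 e3
    _ = (‖u₁ - 1‖ + ‖u₂ - 1‖ + ‖u₃ - 1‖) * ‖Y‖ * ‖Z‖ := by ring

/-- The same with deviation BOUNDS `‖u_i − 1‖ ≤ d_i`: `‖u₁Yu₂Zu₃ − YZ‖ ≤ (d₁ + d₂ + d₃)·‖Y‖·‖Z‖`. [cite: Balaban1985BackgroundPropagators, (3.10) p.392; Balaban1989LargeFieldII, p.357] -/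
theorem norm_unitary_word_sub_le' (u₁ : Matrix (Fin N) (Fin N) ℂ) {u₂ u₃ : Matrix (Fin N) (Fin N) ℂ} (h₂ : u₂ ∈ unitary (Matrix (Fin N) (Fin N) ℂ))
    (h₃ : u₃ ∈ unitary (Matrix (Fin N) (Fin N) ℂ)) (Y Z : Matrix (Fin N) (Fin N) ℂ) {d₁ d₂ d₃ : ℝ} (e₁ : ‖u₁ - 1‖ ≤ d₁) (e₂ : ‖u₂ - 1‖ ≤ d₂) (e₃ : ‖u₃ - 1‖ ≤ d₃) :
    ‖u₁ * Y * u₂ * Z * u₃ - Y * Z‖ ≤ (d₁ + d₂ + d₃) * ‖Y‖ * ‖Z‖ :=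
  (norm_unitary_word_sub_le u₁ h₂ h₃ Y Z).trans
    (mul_le_mul_of_nonneg_right (mul_le_mul_of_nonneg_right (by linarith) (norm_nonneg _)) (norm_nonneg _))

/-- A word with unitary transporters is bounded by its letters: `‖u₁Yu₂Zu₃‖ ≤ ‖Y‖·‖Z‖`. [cite: Balaban1985Averaging, (19)–(20) p.21 (bookkeeping)] -/
theorem norm_unitary_word_le {u₁ u₂ u₃ : Matrix (Fin N) (Fin N) ℂ} (h₁ : u₁ ∈ unitary (Matrix (Fin N) (Fin N) ℂ)) (h₂ : u₂ ∈ unitary (Matrix (Fin N) (Fin N) ℂ))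
    (h₃ : u₃ ∈ unitary (Matrix (Fin N) (Fin N) ℂ)) (Y Z : Matrix (Fin N) (Fin N) ℂ) : ‖u₁ * Y * u₂ * Z * u₃‖ ≤ ‖Y‖ * ‖Z‖ := by
  rw [CStarRing.norm_mul_mem_unitary _ h₃, mul_assoc, mul_assoc, CStarRing.norm_mem_unitary_mul _ h₁, ← mul_assoc]
  exact (norm_mul_le _ _).trans (by rw [CStarRing.norm_mul_mem_unitary _ h₂])

/-- ★ **PER PLAQUETTE, THE (3.2) INSERTED SECOND-VARIATION MATRIX IS BOUNDED BY `(Σ_k‖X_k‖)²`** (unitary transporters cost nothing in the operator norm).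
[cite: Balaban1985BackgroundPropagators, (3.2) p.390; Balaban1985Averaging, (20) p.21] -/
theorem norm_inserted_le (A B C D : SU N) (X₁ X₂ X₃ X₄ : lieSU (Fin N)) :
    ‖(A : Matrix (Fin N) (Fin N) ℂ) * ((X₁ : Matrix (Fin N) (Fin N) ℂ) * (X₁ : Matrix (Fin N) (Fin N) ℂ)) * (B : Matrix (Fin N) (Fin N) ℂ) * star (C : Matrix (Fin N) (Fin N) ℂ) * star (D : Matrix (Fin N) (Fin N) ℂ)
      + (A : Matrix (Fin N) (Fin N) ℂ) * (B : Matrix (Fin N) (Fin N) ℂ) * ((X₂ : Matrix (Fin N) (Fin N) ℂ) * (X₂ : Matrix (Fin N) (Fin N) ℂ)) * star (C : Matrix (Fin N) (Fin N) ℂ) * star (D : Matrix (Fin N) (Fin N) ℂ)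
      + (A : Matrix (Fin N) (Fin N) ℂ) * (B : Matrix (Fin N) (Fin N) ℂ) * ((X₃ : Matrix (Fin N) (Fin N) ℂ) * (X₃ : Matrix (Fin N) (Fin N) ℂ)) * star (C : Matrix (Fin N) (Fin N) ℂ) * star (D : Matrix (Fin N) (Fin N) ℂ)
      + (A : Matrix (Fin N) (Fin N) ℂ) * (B : Matrix (Fin N) (Fin N) ℂ) * star (C : Matrix (Fin N) (Fin N) ℂ) * ((X₄ : Matrix (Fin N) (Fin N) ℂ) * (X₄ : Matrix (Fin N) (Fin N) ℂ)) * star (D : Matrix (Fin N) (Fin N) ℂ)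
      + 2 • ((A : Matrix (Fin N) (Fin N) ℂ) * (X₁ : Matrix (Fin N) (Fin N) ℂ) * (B : Matrix (Fin N) (Fin N) ℂ) * (X₂ : Matrix (Fin N) (Fin N) ℂ) * star (C : Matrix (Fin N) (Fin N) ℂ) * star (D : Matrix (Fin N) (Fin N) ℂ)
          - (A : Matrix (Fin N) (Fin N) ℂ) * (X₁ : Matrix (Fin N) (Fin N) ℂ) * (B : Matrix (Fin N) (Fin N) ℂ) * (X₃ : Matrix (Fin N) (Fin N) ℂ) * star (C : Matrix (Fin N) (Fin N) ℂ) * star (D : Matrix (Fin N) (Fin N) ℂ)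
          - (A : Matrix (Fin N) (Fin N) ℂ) * (X₁ : Matrix (Fin N) (Fin N) ℂ) * (B : Matrix (Fin N) (Fin N) ℂ) * star (C : Matrix (Fin N) (Fin N) ℂ) * (X₄ : Matrix (Fin N) (Fin N) ℂ) * star (D : Matrix (Fin N) (Fin N) ℂ)
          - (A : Matrix (Fin N) (Fin N) ℂ) * (B : Matrix (Fin N) (Fin N) ℂ) * (X₂ : Matrix (Fin N) (Fin N) ℂ) * (X₃ : Matrix (Fin N) (Fin N) ℂ) * star (C : Matrix (Fin N) (Fin N) ℂ) * star (D : Matrix (Fin N) (Fin N) ℂ)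
          - (A : Matrix (Fin N) (Fin N) ℂ) * (B : Matrix (Fin N) (Fin N) ℂ) * (X₂ : Matrix (Fin N) (Fin N) ℂ) * star (C : Matrix (Fin N) (Fin N) ℂ) * (X₄ : Matrix (Fin N) (Fin N) ℂ) * star (D : Matrix (Fin N) (Fin N) ℂ)
          + (A : Matrix (Fin N) (Fin N) ℂ) * (B : Matrix (Fin N) (Fin N) ℂ) * (X₃ : Matrix (Fin N) (Fin N) ℂ) * star (C : Matrix (Fin N) (Fin N) ℂ) * (X₄ : Matrix (Fin N) (Fin N) ℂ) * star (D : Matrix (Fin N) (Fin N) ℂ))‖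
      ≤ (‖(X₁ : Matrix (Fin N) (Fin N) ℂ)‖ + ‖(X₂ : Matrix (Fin N) (Fin N) ℂ)‖ + ‖(X₃ : Matrix (Fin N) (Fin N) ℂ)‖ + ‖(X₄ : Matrix (Fin N) (Fin N) ℂ)‖) ^ 2 := by
  have uA : (A : Matrix (Fin N) (Fin N) ℂ) ∈ unitary (Matrix (Fin N) (Fin N) ℂ) := A.2.1
  have uB : (B : Matrix (Fin N) (Fin N) ℂ) ∈ unitary (Matrix (Fin N) (Fin N) ℂ) := B.2.1
  have uC : star (C : Matrix (Fin N) (Fin N) ℂ) ∈ unitary (Matrix (Fin N) (Fin N) ℂ) := Unitary.star_mem C.2.1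
  have uD : star (D : Matrix (Fin N) (Fin N) ℂ) ∈ unitary (Matrix (Fin N) (Fin N) ℂ) := Unitary.star_mem D.2.1
  have u1 : (1 : Matrix (Fin N) (Fin N) ℂ) ∈ unitary (Matrix (Fin N) (Fin N) ℂ) := Submonoid.one_mem _
  have uAB := mul_mem uA uB
  have uCD := mul_mem uC uD
  have uBC := mul_mem uB uC
  have uBCD := mul_mem uBC uD
  have uABC := mul_mem uAB uC
  have w11 := norm_unitary_word_le uA u1 uBCD (X₁ : Matrix (Fin N) (Fin N) ℂ) (X₁ : Matrix (Fin N) (Fin N) ℂ)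
  have w22 := norm_unitary_word_le uAB u1 uCD (X₂ : Matrix (Fin N) (Fin N) ℂ) (X₂ : Matrix (Fin N) (Fin N) ℂ)
  have w33 := norm_unitary_word_le uAB u1 uCD (X₃ : Matrix (Fin N) (Fin N) ℂ) (X₃ : Matrix (Fin N) (Fin N) ℂ)
  have w44 := norm_unitary_word_le uABC u1 uD (X₄ : Matrix (Fin N) (Fin N) ℂ) (X₄ : Matrix (Fin N) (Fin N) ℂ)
  have w12 := norm_unitary_word_le uA uB uCD (X₁ : Matrix (Fin N) (Fin N) ℂ) (X₂ : Matrix (Fin N) (Fin N) ℂ)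
  have w13 := norm_unitary_word_le uA uB uCD (X₁ : Matrix (Fin N) (Fin N) ℂ) (X₃ : Matrix (Fin N) (Fin N) ℂ)
  have w14 := norm_unitary_word_le uA uBC uD (X₁ : Matrix (Fin N) (Fin N) ℂ) (X₄ : Matrix (Fin N) (Fin N) ℂ)
  have w23 := norm_unitary_word_le uAB u1 uCD (X₂ : Matrix (Fin N) (Fin N) ℂ) (X₃ : Matrix (Fin N) (Fin N) ℂ)
  have w24 := norm_unitary_word_le uAB uC uD (X₂ : Matrix (Fin N) (Fin N) ℂ) (X₄ : Matrix (Fin N) (Fin N) ℂ)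
  have w34 := norm_unitary_word_le uAB uC uD (X₃ : Matrix (Fin N) (Fin N) ℂ) (X₄ : Matrix (Fin N) (Fin N) ℂ)
  simp only [mul_assoc, mul_one] at w11 w22 w33 w44 w12 w13 w14 w23 w24 w34 ⊢
  have hns : ∀ (Q : Matrix (Fin N) (Fin N) ℂ) (r : ℝ), ‖Q‖ ≤ r → ‖2 • Q‖ ≤ 2 * r := fun Q r h =>
    norm_nsmul_le.trans (by rw [Nat.cast_ofNat]; exact mul_le_mul_of_nonneg_left h (by norm_num))
  have hsq := (norm_add_le _ _).trans (add_le_add ((norm_add_le _ _).trans (add_le_add ((norm_add_le _ _).trans (add_le_add w11 w22)) w33)) w44)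
  have hpairs := hns _ _ ((norm_add_le _ _).trans (add_le_add ((norm_sub_le _ _).trans (add_le_add ((norm_sub_le _ _).trans (add_le_add
    ((norm_sub_le _ _).trans (add_le_add ((norm_sub_le _ _).trans (add_le_add w12 w13)) w14)) w23)) w24)) w34))
  refine ((norm_add_le _ _).trans (add_le_add hsq hpairs)).trans (le_of_eq ?_)
  ring

/-- ★ **PER PLAQUETTE: THE (3.2) INSERTED SECOND VARIATION AT `(A, B, C, D)` IS WITHIN `4N·δ·(Σ_k‖X_k‖)²` OF ITS FLAT VALUE** (all `A = B = C = D = 1`), `δ` a bound of the four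
bond deviations `‖A−1‖, ‖B−1‖, ‖C−1‖, ‖D−1‖` — the «first order in A₀» expansion of [B16] p.357 ∕ the smallness of `Δ′ = Δ − D*D` of [B9] (3.10) in the letters of this chain.
[cite: Balaban1985BackgroundPropagators, (3.10) p.392; Balaban1989LargeFieldII, p.357] -/
theorem norm_inserted_sub_flat_le (A B C D : SU N) (X₁ X₂ X₃ X₄ : lieSU (Fin N)) {δ : ℝ}
    (hA : ‖(A : Matrix (Fin N) (Fin N) ℂ) - 1‖ ≤ δ) (hB : ‖(B : Matrix (Fin N) (Fin N) ℂ) - 1‖ ≤ δ)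
    (hC : ‖(C : Matrix (Fin N) (Fin N) ℂ) - 1‖ ≤ δ) (hD : ‖(D : Matrix (Fin N) (Fin N) ℂ) - 1‖ ≤ δ) :
    ‖((A : Matrix (Fin N) (Fin N) ℂ) * ((X₁ : Matrix (Fin N) (Fin N) ℂ) * (X₁ : Matrix (Fin N) (Fin N) ℂ)) * (B : Matrix (Fin N) (Fin N) ℂ) * star (C : Matrix (Fin N) (Fin N) ℂ) * star (D : Matrix (Fin N) (Fin N) ℂ)
      + (A : Matrix (Fin N) (Fin N) ℂ) * (B : Matrix (Fin N) (Fin N) ℂ) * ((X₂ : Matrix (Fin N) (Fin N) ℂ) * (X₂ : Matrix (Fin N) (Fin N) ℂ)) * star (C : Matrix (Fin N) (Fin N) ℂ) * star (D : Matrix (Fin N) (Fin N) ℂ)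
      + (A : Matrix (Fin N) (Fin N) ℂ) * (B : Matrix (Fin N) (Fin N) ℂ) * ((X₃ : Matrix (Fin N) (Fin N) ℂ) * (X₃ : Matrix (Fin N) (Fin N) ℂ)) * star (C : Matrix (Fin N) (Fin N) ℂ) * star (D : Matrix (Fin N) (Fin N) ℂ)
      + (A : Matrix (Fin N) (Fin N) ℂ) * (B : Matrix (Fin N) (Fin N) ℂ) * star (C : Matrix (Fin N) (Fin N) ℂ) * ((X₄ : Matrix (Fin N) (Fin N) ℂ) * (X₄ : Matrix (Fin N) (Fin N) ℂ)) * star (D : Matrix (Fin N) (Fin N) ℂ)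
      + 2 • ((A : Matrix (Fin N) (Fin N) ℂ) * (X₁ : Matrix (Fin N) (Fin N) ℂ) * (B : Matrix (Fin N) (Fin N) ℂ) * (X₂ : Matrix (Fin N) (Fin N) ℂ) * star (C : Matrix (Fin N) (Fin N) ℂ) * star (D : Matrix (Fin N) (Fin N) ℂ)
          - (A : Matrix (Fin N) (Fin N) ℂ) * (X₁ : Matrix (Fin N) (Fin N) ℂ) * (B : Matrix (Fin N) (Fin N) ℂ) * (X₃ : Matrix (Fin N) (Fin N) ℂ) * star (C : Matrix (Fin N) (Fin N) ℂ) * star (D : Matrix (Fin N) (Fin N) ℂ)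
          - (A : Matrix (Fin N) (Fin N) ℂ) * (X₁ : Matrix (Fin N) (Fin N) ℂ) * (B : Matrix (Fin N) (Fin N) ℂ) * star (C : Matrix (Fin N) (Fin N) ℂ) * (X₄ : Matrix (Fin N) (Fin N) ℂ) * star (D : Matrix (Fin N) (Fin N) ℂ)
          - (A : Matrix (Fin N) (Fin N) ℂ) * (B : Matrix (Fin N) (Fin N) ℂ) * (X₂ : Matrix (Fin N) (Fin N) ℂ) * (X₃ : Matrix (Fin N) (Fin N) ℂ) * star (C : Matrix (Fin N) (Fin N) ℂ) * star (D : Matrix (Fin N) (Fin N) ℂ)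
          - (A : Matrix (Fin N) (Fin N) ℂ) * (B : Matrix (Fin N) (Fin N) ℂ) * (X₂ : Matrix (Fin N) (Fin N) ℂ) * star (C : Matrix (Fin N) (Fin N) ℂ) * (X₄ : Matrix (Fin N) (Fin N) ℂ) * star (D : Matrix (Fin N) (Fin N) ℂ)
          + (A : Matrix (Fin N) (Fin N) ℂ) * (B : Matrix (Fin N) (Fin N) ℂ) * (X₃ : Matrix (Fin N) (Fin N) ℂ) * star (C : Matrix (Fin N) (Fin N) ℂ) * (X₄ : Matrix (Fin N) (Fin N) ℂ) * star (D : Matrix (Fin N) (Fin N) ℂ)))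
      - ((X₁ : Matrix (Fin N) (Fin N) ℂ) * (X₁ : Matrix (Fin N) (Fin N) ℂ) + (X₂ : Matrix (Fin N) (Fin N) ℂ) * (X₂ : Matrix (Fin N) (Fin N) ℂ)
          + (X₃ : Matrix (Fin N) (Fin N) ℂ) * (X₃ : Matrix (Fin N) (Fin N) ℂ) + (X₄ : Matrix (Fin N) (Fin N) ℂ) * (X₄ : Matrix (Fin N) (Fin N) ℂ)
        + 2 • ((X₁ : Matrix (Fin N) (Fin N) ℂ) * (X₂ : Matrix (Fin N) (Fin N) ℂ) - (X₁ : Matrix (Fin N) (Fin N) ℂ) * (X₃ : Matrix (Fin N) (Fin N) ℂ)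
          - (X₁ : Matrix (Fin N) (Fin N) ℂ) * (X₄ : Matrix (Fin N) (Fin N) ℂ) - (X₂ : Matrix (Fin N) (Fin N) ℂ) * (X₃ : Matrix (Fin N) (Fin N) ℂ)
          - (X₂ : Matrix (Fin N) (Fin N) ℂ) * (X₄ : Matrix (Fin N) (Fin N) ℂ) + (X₃ : Matrix (Fin N) (Fin N) ℂ) * (X₄ : Matrix (Fin N) (Fin N) ℂ)))‖
      ≤ 4 * δ * (‖(X₁ : Matrix (Fin N) (Fin N) ℂ)‖ + ‖(X₂ : Matrix (Fin N) (Fin N) ℂ)‖ + ‖(X₃ : Matrix (Fin N) (Fin N) ℂ)‖ + ‖(X₄ : Matrix (Fin N) (Fin N) ℂ)‖) ^ 2 := by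
  -- unitary memberships and deviations of the transporting words
  have uA : (A : Matrix (Fin N) (Fin N) ℂ) ∈ unitary (Matrix (Fin N) (Fin N) ℂ) := A.2.1
  have uB : (B : Matrix (Fin N) (Fin N) ℂ) ∈ unitary (Matrix (Fin N) (Fin N) ℂ) := B.2.1
  have uC : star (C : Matrix (Fin N) (Fin N) ℂ) ∈ unitary (Matrix (Fin N) (Fin N) ℂ) := Unitary.star_mem C.2.1
  have uD : star (D : Matrix (Fin N) (Fin N) ℂ) ∈ unitary (Matrix (Fin N) (Fin N) ℂ) := Unitary.star_mem D.2.1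
  have u1 : (1 : Matrix (Fin N) (Fin N) ℂ) ∈ unitary (Matrix (Fin N) (Fin N) ℂ) := Submonoid.one_mem _
  have uAB := mul_mem uA uB
  have uCD := mul_mem uC uD
  have uBC := mul_mem uB uC
  have uBCD := mul_mem uBC uD
  have uABC := mul_mem uAB uC
  have hC' : ‖star (C : Matrix (Fin N) (Fin N) ℂ) - 1‖ ≤ δ := by rw [norm_star_sub_one]; exact hC
  have hD' : ‖star (D : Matrix (Fin N) (Fin N) ℂ) - 1‖ ≤ δ := by rw [norm_star_sub_one]; exact hD
  have h1 : ‖(1 : Matrix (Fin N) (Fin N) ℂ) - 1‖ ≤ 0 := by rw [sub_self, norm_zero]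
  have hAB : ‖(A : Matrix (Fin N) (Fin N) ℂ) * (B : Matrix (Fin N) (Fin N) ℂ) - 1‖ ≤ δ + δ := (norm_mul_sub_one_le uA _).trans (add_le_add hA hB)
  have hCD : ‖star (C : Matrix (Fin N) (Fin N) ℂ) * star (D : Matrix (Fin N) (Fin N) ℂ) - 1‖ ≤ δ + δ := (norm_mul_sub_one_le uC _).trans (add_le_add hC' hD')
  have hBC : ‖(B : Matrix (Fin N) (Fin N) ℂ) * star (C : Matrix (Fin N) (Fin N) ℂ) - 1‖ ≤ δ + δ := (norm_mul_sub_one_le uB _).trans (add_le_add hB hC')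
  have hBCD : ‖(B : Matrix (Fin N) (Fin N) ℂ) * star (C : Matrix (Fin N) (Fin N) ℂ) * star (D : Matrix (Fin N) (Fin N) ℂ) - 1‖ ≤ δ + δ + δ :=
    (norm_mul_sub_one_le uBC _).trans (add_le_add hBC hD')
  have hABC : ‖(A : Matrix (Fin N) (Fin N) ℂ) * (B : Matrix (Fin N) (Fin N) ℂ) * star (C : Matrix (Fin N) (Fin N) ℂ) - 1‖ ≤ δ + δ + δ :=
    (norm_mul_sub_one_le uAB _).trans (add_le_add hAB hC')
  have hδ : 0 ≤ δ := (norm_nonneg _).trans hA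
  -- the ten words, each within `4δ·‖Y‖‖Z‖` of its flat value
  have w11 := norm_unitary_word_sub_le' (A : Matrix (Fin N) (Fin N) ℂ) u1 uBCD (X₁ : Matrix (Fin N) (Fin N) ℂ) (X₁ : Matrix (Fin N) (Fin N) ℂ) hA h1 hBCD
  have w22 := norm_unitary_word_sub_le' ((A : Matrix (Fin N) (Fin N) ℂ) * (B : Matrix (Fin N) (Fin N) ℂ)) u1 uCD (X₂ : Matrix (Fin N) (Fin N) ℂ) (X₂ : Matrix (Fin N) (Fin N) ℂ) hAB h1 hCD
  have w33 := norm_unitary_word_sub_le' ((A : Matrix (Fin N) (Fin N) ℂ) * (B : Matrix (Fin N) (Fin N) ℂ)) u1 uCD (X₃ : Matrix (Fin N) (Fin N) ℂ) (X₃ : Matrix (Fin N) (Fin N) ℂ) hAB h1 hCD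
  have w44 := norm_unitary_word_sub_le' ((A : Matrix (Fin N) (Fin N) ℂ) * (B : Matrix (Fin N) (Fin N) ℂ) * star (C : Matrix (Fin N) (Fin N) ℂ)) u1 uD
    (X₄ : Matrix (Fin N) (Fin N) ℂ) (X₄ : Matrix (Fin N) (Fin N) ℂ) hABC h1 hD'
  have w12 := norm_unitary_word_sub_le' (A : Matrix (Fin N) (Fin N) ℂ) uB uCD (X₁ : Matrix (Fin N) (Fin N) ℂ) (X₂ : Matrix (Fin N) (Fin N) ℂ) hA hB hCD
  have w13 := norm_unitary_word_sub_le' (A : Matrix (Fin N) (Fin N) ℂ) uB uCD (X₁ : Matrix (Fin N) (Fin N) ℂ) (X₃ : Matrix (Fin N) (Fin N) ℂ) hA hB hCD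
  have w14 := norm_unitary_word_sub_le' (A : Matrix (Fin N) (Fin N) ℂ) uBC uD (X₁ : Matrix (Fin N) (Fin N) ℂ) (X₄ : Matrix (Fin N) (Fin N) ℂ) hA hBC hD'
  have w23 := norm_unitary_word_sub_le' ((A : Matrix (Fin N) (Fin N) ℂ) * (B : Matrix (Fin N) (Fin N) ℂ)) u1 uCD (X₂ : Matrix (Fin N) (Fin N) ℂ) (X₃ : Matrix (Fin N) (Fin N) ℂ) hAB h1 hCD
  have w24 := norm_unitary_word_sub_le' ((A : Matrix (Fin N) (Fin N) ℂ) * (B : Matrix (Fin N) (Fin N) ℂ)) uC uD (X₂ : Matrix (Fin N) (Fin N) ℂ) (X₄ : Matrix (Fin N) (Fin N) ℂ) hAB hC' hD'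
  have w34 := norm_unitary_word_sub_le' ((A : Matrix (Fin N) (Fin N) ℂ) * (B : Matrix (Fin N) (Fin N) ℂ)) uC uD (X₃ : Matrix (Fin N) (Fin N) ℂ) (X₄ : Matrix (Fin N) (Fin N) ℂ) hAB hC' hD'
  -- regroup the difference word by word
  have key : ∀ (s11 s22 s33 s44 p12 p13 p14 p23 p24 p34 f11 f22 f33 f44 q12 q13 q14 q23 q24 q34 : Matrix (Fin N) (Fin N) ℂ),
      s11 + s22 + s33 + s44 + 2 • (p12 - p13 - p14 - p23 - p24 + p34) - (f11 + f22 + f33 + f44 + 2 • (q12 - q13 - q14 - q23 - q24 + q34))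
        = (s11 - f11) + (s22 - f22) + (s33 - f33) + (s44 - f44)
          + 2 • ((p12 - q12) - (p13 - q13) - (p14 - q14) - (p23 - q23) - (p24 - q24) + (p34 - q34)) := by
    intros; simp only [smul_sub, smul_add]; abel
  rw [key]
  simp only [mul_assoc, mul_one] at w11 w22 w33 w44 w12 w13 w14 w23 w24 w34 ⊢
  have hns : ∀ (Q : Matrix (Fin N) (Fin N) ℂ) (r : ℝ), ‖Q‖ ≤ r → ‖2 • Q‖ ≤ 2 * r := fun Q r h =>
    norm_nsmul_le.trans (by rw [Nat.cast_ofNat]; exact mul_le_mul_of_nonneg_left h (by norm_num))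
  have hsq := (norm_add_le _ _).trans (add_le_add ((norm_add_le _ _).trans (add_le_add ((norm_add_le _ _).trans (add_le_add w11 w22)) w33)) w44)
  have hpairs := hns _ _ ((norm_add_le _ _).trans (add_le_add ((norm_sub_le _ _).trans (add_le_add ((norm_sub_le _ _).trans (add_le_add
    ((norm_sub_le _ _).trans (add_le_add ((norm_sub_le _ _).trans (add_le_add w12 w13)) w14)) w23)) w24)) w34))
  refine ((norm_add_le _ _).trans (add_le_add hsq hpairs)).trans (le_of_eq ?_)
  ring

end UnitaryDeviation

/-! ## §2  On the lattice: the two-sided comparison with the flat background, and the flat value -/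

section Lattice

variable {P : Params} {j : ℕ} {N : ℕ} [NeZero N]

/-- The trivial configuration has bond matrices `1`. [cite: Balaban1985BackgroundPropagators, (3.10) p.392 (bookkeeping)] -/
theorem coe_one_apply_SU (b : PBond P j) : (((1 : GaugeField P j (SU N)) b : SU N) : Matrix (Fin N) (Fin N) ℂ) = 1 := rfl

/-- ★★★ **PLAQUETTE-LOCAL FORM**: with a deviation budget `δ p` for the four bond variables of EACH plaquette (`‖U_b − 1‖ ≤ δ p` for `b ⊂ ∂p`; where `X` vanishes on `∂p` the
plaquette contributes `0` whatever `δ p` is, so `δ p := 2` is always admissible there),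
`|d²∕dt² A(U·e^{tX})∣₀ − d²∕dt² A(1·e^{tX})∣₀| ≤ 4·Σ_p δ_p·(‖X_{b₁}‖ + ‖X_{b₂}‖ + ‖X_{b₃}‖ + ‖X_{b₄}‖)²` — the background need only be near `1` on the plaquettes that see `X`
([B16] p.357: `U₀` is represented as `exp iξA₀` with `A₀` small ON THE DOMAIN `Z`). [cite: Balaban1989LargeFieldII, p.357, (1.7) p.358; Balaban1985BackgroundPropagators, (3.10) p.392] -/
theorem abs_deriv_deriv_wilsonAction4_expChart_sub_flat_le_local (U : GaugeField P j (SU N)) (X : PBond P j → lieSU (Fin N)) (δ : Plaq P j → ℝ)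
    (hδ : ∀ p : Plaq P j, ‖(U ⟨p.src, p.μ⟩ : Matrix (Fin N) (Fin N) ℂ) - 1‖ ≤ δ p ∧ ‖(U ⟨p.src.shift p.μ, p.ν⟩ : Matrix (Fin N) (Fin N) ℂ) - 1‖ ≤ δ p
      ∧ ‖(U ⟨p.src.shift p.ν, p.μ⟩ : Matrix (Fin N) (Fin N) ℂ) - 1‖ ≤ δ p ∧ ‖(U ⟨p.src, p.ν⟩ : Matrix (Fin N) (Fin N) ℂ) - 1‖ ≤ δ p) :
    |deriv (deriv fun s : ℝ => wilsonAction4 (expChart U (s • X))) 0 - deriv (deriv fun s : ℝ => wilsonAction4 (expChart 1 (s • X))) 0|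
      ≤ 4 * ∑ p : Plaq P j, δ p * (‖(X ⟨p.src, p.μ⟩ : Matrix (Fin N) (Fin N) ℂ)‖ + ‖(X ⟨p.src.shift p.μ, p.ν⟩ : Matrix (Fin N) (Fin N) ℂ)‖ + ‖(X ⟨p.src.shift p.ν, p.μ⟩ : Matrix (Fin N) (Fin N) ℂ)‖ + ‖(X ⟨p.src, p.ν⟩ : Matrix (Fin N) (Fin N) ℂ)‖) ^ 2 := by
  rw [(hasDerivAt_deriv_wilsonAction4_expChart_inserted U X).deriv, (hasDerivAt_deriv_wilsonAction4_expChart_inserted 1 X).deriv]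
  simp only [coe_one_apply_SU, one_mul, mul_one, star_one]
  rw [show ∀ (a b : Plaq P j → ℝ) (N' : ℝ), -(∑ p, a p) / N' - -(∑ p, b p) / N' = ∑ p, -((a p - b p) / N') by
    intro a b N'; simp only [neg_div, Finset.sum_div, sub_div, Finset.sum_sub_distrib, neg_sub, sub_neg_eq_add]; ring,
    Finset.mul_sum]
  refine (Finset.abs_sum_le_sum_abs _ _).trans (Finset.sum_le_sum fun p _ => ?_)
  rw [abs_neg, ← Complex.sub_re, ← Matrix.trace_sub]
  exact (MatrixNorms.abs_nReTr_le_opNorm _).trans ((norm_inserted_sub_flat_le (U ⟨p.src, p.μ⟩) (U ⟨p.src.shift p.μ, p.ν⟩) (U ⟨p.src.shift p.ν, p.μ⟩) (U ⟨p.src, p.ν⟩)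
    (X ⟨p.src, p.μ⟩) (X ⟨p.src.shift p.μ, p.ν⟩) (X ⟨p.src.shift p.ν, p.μ⟩) (X ⟨p.src, p.ν⟩) (hδ p).1 (hδ p).2.1 (hδ p).2.2.1 (hδ p).2.2.2).trans_eq (mul_assoc _ _ _))

/-- ★★★ **THE SECOND VARIATION AT `U` IS WITHIN `4δ·Σ_p s_p²` OF THE FLAT ONE** — letter (b) of the U2 lane, two-sided, at the level of the Wilson action: if every bond variable of the
background satisfies `‖U_b − 1‖ ≤ δ` (operator norm), then for every direction `X : bonds → 𝔰𝔲(N)`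
`|d²∕dt² A(U·e^{tX})∣₀ − d²∕dt² A(1·e^{tX})∣₀| ≤ 4δ·Σ_p (‖X_{b₁}‖ + ‖X_{b₂}‖ + ‖X_{b₃}‖ + ‖X_{b₄}‖)²` (plaquettes off the support of `X` contribute `0`).  [B16] p.357 «we expand … with respect to
A₀, up to the first order in A₀ … The leading term in the expansion is the quadratic form with the background field identically equal to 1»; [B9] (3.10) «Δ′ … a bounded, small operator».
[cite: Balaban1989LargeFieldII, p.357, (1.7) p.358; Balaban1985BackgroundPropagators, (3.10) p.392] -/
theorem abs_deriv_deriv_wilsonAction4_expChart_sub_flat_le (U : GaugeField P j (SU N)) (X : PBond P j → lieSU (Fin N)) {δ : ℝ}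
    (hδ : ∀ b : PBond P j, ‖(U b : Matrix (Fin N) (Fin N) ℂ) - 1‖ ≤ δ) :
    |deriv (deriv fun s : ℝ => wilsonAction4 (expChart U (s • X))) 0 - deriv (deriv fun s : ℝ => wilsonAction4 (expChart 1 (s • X))) 0|
      ≤ 4 * δ * ∑ p : Plaq P j, (‖(X ⟨p.src, p.μ⟩ : Matrix (Fin N) (Fin N) ℂ)‖ + ‖(X ⟨p.src.shift p.μ, p.ν⟩ : Matrix (Fin N) (Fin N) ℂ)‖ + ‖(X ⟨p.src.shift p.ν, p.μ⟩ : Matrix (Fin N) (Fin N) ℂ)‖ + ‖(X ⟨p.src, p.ν⟩ : Matrix (Fin N) (Fin N) ℂ)‖) ^ 2 := by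
  rw [mul_assoc, Finset.mul_sum]
  exact abs_deriv_deriv_wilsonAction4_expChart_sub_flat_le_local U X (fun _ => δ) fun p => ⟨hδ _, hδ _, hδ _, hδ _⟩

/-- ★★ **THE SECOND VARIATION IS BOUNDED BY THE LETTERS**: `|d²∕dt² A(U·e^{tX})∣₀| ≤ Σ_p (‖X_{b₁}‖ + ‖X_{b₂}‖ + ‖X_{b₃}‖ + ‖X_{b₄}‖)²` for EVERY background `U` (the operator `Δ(U)` of
[B9] p.392 is bounded uniformly in `U` in this normalisation; B7 (20) `|Re tr M| ≤ ‖M‖`). [cite: Balaban1985BackgroundPropagators, (3.10) p.392 («a bounded … operator»); Balaban1985Averaging, (20) p.21] -/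
theorem abs_deriv_deriv_wilsonAction4_expChart_le (U : GaugeField P j (SU N)) (X : PBond P j → lieSU (Fin N)) :
    |deriv (deriv fun s : ℝ => wilsonAction4 (expChart U (s • X))) 0| ≤ ∑ p : Plaq P j, (‖(X ⟨p.src, p.μ⟩ : Matrix (Fin N) (Fin N) ℂ)‖ + ‖(X ⟨p.src.shift p.μ, p.ν⟩ : Matrix (Fin N) (Fin N) ℂ)‖ + ‖(X ⟨p.src.shift p.ν, p.μ⟩ : Matrix (Fin N) (Fin N) ℂ)‖ + ‖(X ⟨p.src, p.ν⟩ : Matrix (Fin N) (Fin N) ℂ)‖) ^ 2 := by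
  rw [(hasDerivAt_deriv_wilsonAction4_expChart_inserted U X).deriv, abs_div, abs_neg, Nat.abs_cast]
  rw [div_le_iff₀ (Nat.cast_pos.mpr (Fintype.card_pos (α := Fin N))), Finset.sum_mul]
  refine (Finset.abs_sum_le_sum_abs _ _).trans (Finset.sum_le_sum fun p _ => ?_)
  have h := MatrixNorms.abs_nReTr_le_opNorm
    ((U ⟨p.src, p.μ⟩ : Matrix (Fin N) (Fin N) ℂ) * ((X ⟨p.src, p.μ⟩ : Matrix (Fin N) (Fin N) ℂ) * (X ⟨p.src, p.μ⟩ : Matrix (Fin N) (Fin N) ℂ))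
      * (U ⟨p.src.shift p.μ, p.ν⟩ : Matrix (Fin N) (Fin N) ℂ) * star (U ⟨p.src.shift p.ν, p.μ⟩ : Matrix (Fin N) (Fin N) ℂ) * star (U ⟨p.src, p.ν⟩ : Matrix (Fin N) (Fin N) ℂ)
    + (U ⟨p.src, p.μ⟩ : Matrix (Fin N) (Fin N) ℂ) * (U ⟨p.src.shift p.μ, p.ν⟩ : Matrix (Fin N) (Fin N) ℂ)
      * ((X ⟨p.src.shift p.μ, p.ν⟩ : Matrix (Fin N) (Fin N) ℂ) * (X ⟨p.src.shift p.μ, p.ν⟩ : Matrix (Fin N) (Fin N) ℂ)) * star (U ⟨p.src.shift p.ν, p.μ⟩ : Matrix (Fin N) (Fin N) ℂ) * star (U ⟨p.src, p.ν⟩ : Matrix (Fin N) (Fin N) ℂ)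
    + (U ⟨p.src, p.μ⟩ : Matrix (Fin N) (Fin N) ℂ) * (U ⟨p.src.shift p.μ, p.ν⟩ : Matrix (Fin N) (Fin N) ℂ)
      * ((X ⟨p.src.shift p.ν, p.μ⟩ : Matrix (Fin N) (Fin N) ℂ) * (X ⟨p.src.shift p.ν, p.μ⟩ : Matrix (Fin N) (Fin N) ℂ)) * star (U ⟨p.src.shift p.ν, p.μ⟩ : Matrix (Fin N) (Fin N) ℂ) * star (U ⟨p.src, p.ν⟩ : Matrix (Fin N) (Fin N) ℂ)
    + (U ⟨p.src, p.μ⟩ : Matrix (Fin N) (Fin N) ℂ) * (U ⟨p.src.shift p.μ, p.ν⟩ : Matrix (Fin N) (Fin N) ℂ) * star (U ⟨p.src.shift p.ν, p.μ⟩ : Matrix (Fin N) (Fin N) ℂ)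
      * ((X ⟨p.src, p.ν⟩ : Matrix (Fin N) (Fin N) ℂ) * (X ⟨p.src, p.ν⟩ : Matrix (Fin N) (Fin N) ℂ)) * star (U ⟨p.src, p.ν⟩ : Matrix (Fin N) (Fin N) ℂ)
    + 2 • ((U ⟨p.src, p.μ⟩ : Matrix (Fin N) (Fin N) ℂ) * (X ⟨p.src, p.μ⟩ : Matrix (Fin N) (Fin N) ℂ) * (U ⟨p.src.shift p.μ, p.ν⟩ : Matrix (Fin N) (Fin N) ℂ) * (X ⟨p.src.shift p.μ, p.ν⟩ : Matrix (Fin N) (Fin N) ℂ) * star (U ⟨p.src.shift p.ν, p.μ⟩ : Matrix (Fin N) (Fin N) ℂ) * star (U ⟨p.src, p.ν⟩ : Matrix (Fin N) (Fin N) ℂ)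
      - (U ⟨p.src, p.μ⟩ : Matrix (Fin N) (Fin N) ℂ) * (X ⟨p.src, p.μ⟩ : Matrix (Fin N) (Fin N) ℂ) * (U ⟨p.src.shift p.μ, p.ν⟩ : Matrix (Fin N) (Fin N) ℂ) * (X ⟨p.src.shift p.ν, p.μ⟩ : Matrix (Fin N) (Fin N) ℂ) * star (U ⟨p.src.shift p.ν, p.μ⟩ : Matrix (Fin N) (Fin N) ℂ) * star (U ⟨p.src, p.ν⟩ : Matrix (Fin N) (Fin N) ℂ)
      - (U ⟨p.src, p.μ⟩ : Matrix (Fin N) (Fin N) ℂ) * (X ⟨p.src, p.μ⟩ : Matrix (Fin N) (Fin N) ℂ) * (U ⟨p.src.shift p.μ, p.ν⟩ : Matrix (Fin N) (Fin N) ℂ) * star (U ⟨p.src.shift p.ν, p.μ⟩ : Matrix (Fin N) (Fin N) ℂ) * (X ⟨p.src, p.ν⟩ : Matrix (Fin N) (Fin N) ℂ) * star (U ⟨p.src, p.ν⟩ : Matrix (Fin N) (Fin N) ℂ)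
      - (U ⟨p.src, p.μ⟩ : Matrix (Fin N) (Fin N) ℂ) * (U ⟨p.src.shift p.μ, p.ν⟩ : Matrix (Fin N) (Fin N) ℂ) * (X ⟨p.src.shift p.μ, p.ν⟩ : Matrix (Fin N) (Fin N) ℂ) * (X ⟨p.src.shift p.ν, p.μ⟩ : Matrix (Fin N) (Fin N) ℂ) * star (U ⟨p.src.shift p.ν, p.μ⟩ : Matrix (Fin N) (Fin N) ℂ) * star (U ⟨p.src, p.ν⟩ : Matrix (Fin N) (Fin N) ℂ)
      - (U ⟨p.src, p.μ⟩ : Matrix (Fin N) (Fin N) ℂ) * (U ⟨p.src.shift p.μ, p.ν⟩ : Matrix (Fin N) (Fin N) ℂ) * (X ⟨p.src.shift p.μ, p.ν⟩ : Matrix (Fin N) (Fin N) ℂ) * star (U ⟨p.src.shift p.ν, p.μ⟩ : Matrix (Fin N) (Fin N) ℂ) * (X ⟨p.src, p.ν⟩ : Matrix (Fin N) (Fin N) ℂ) * star (U ⟨p.src, p.ν⟩ : Matrix (Fin N) (Fin N) ℂ)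
      + (U ⟨p.src, p.μ⟩ : Matrix (Fin N) (Fin N) ℂ) * (U ⟨p.src.shift p.μ, p.ν⟩ : Matrix (Fin N) (Fin N) ℂ) * (X ⟨p.src.shift p.ν, p.μ⟩ : Matrix (Fin N) (Fin N) ℂ) * star (U ⟨p.src.shift p.ν, p.μ⟩ : Matrix (Fin N) (Fin N) ℂ) * (X ⟨p.src, p.ν⟩ : Matrix (Fin N) (Fin N) ℂ) * star (U ⟨p.src, p.ν⟩ : Matrix (Fin N) (Fin N) ℂ)))
  unfold UnitaryModel.nReTr at h
  rw [abs_div, Nat.abs_cast, div_le_iff₀ (Nat.cast_pos.mpr (Fintype.card_pos (α := Fin N)))] at h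
  exact h.trans (mul_le_mul_of_nonneg_right (norm_inserted_le _ _ _ _ _ _ _ _) (Nat.cast_nonneg _))

/-- ★ **THE FLAT VALUE**: at `U ≡ 1` the transported letters are the bare `±𝕏_b`, every plaquette variable is `1`, and
`d²∕dt² A(e^{tX})∣₀ = (1∕N)·Σ_p Re Tr(σ⁰_p⋆σ⁰_p)`, `σ⁰_p = 𝕏⟨x,μ⟩ + 𝕏⟨x+e_μ,ν⟩ − 𝕏⟨x+e_ν,μ⟩ − 𝕏⟨x,ν⟩` the plain lattice curl — «the quadratic form with the background field identically equal to 1»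
([B16] p.357), «generalizing the operator ∂*∂ in the Abelian case» ([B9] p.392); the object U2c reads per 𝔤-coordinate against `formDk` of [10] (1.65)–(1.66).
[cite: Balaban1989LargeFieldII, p.357; Balaban1985BackgroundPropagators, (3.10) p.392; Balaban1984PropagatorsI, (1.65) p.29] -/
theorem deriv_deriv_wilsonAction4_expChart_one (X : PBond P j → lieSU (Fin N)) :
    deriv (deriv fun s : ℝ => wilsonAction4 (expChart (1 : GaugeField P j (SU N)) (s • X))) 0
      = (∑ p : Plaq P j, (Matrix.trace (star ((X ⟨p.src, p.μ⟩ : Matrix (Fin N) (Fin N) ℂ) + (X ⟨p.src.shift p.μ, p.ν⟩ : Matrix (Fin N) (Fin N) ℂ) - (X ⟨p.src.shift p.ν, p.μ⟩ : Matrix (Fin N) (Fin N) ℂ) - (X ⟨p.src, p.ν⟩ : Matrix (Fin N) (Fin N) ℂ)) * ((X ⟨p.src, p.μ⟩ : Matrix (Fin N) (Fin N) ℂ) + (X ⟨p.src.shift p.μ, p.ν⟩ : Matrix (Fin N) (Fin N) ℂ) - (X ⟨p.src.shift p.ν, p.μ⟩ : Matrix (Fin N) (Fin N) ℂ) - (X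 ⟨p.src, p.ν⟩ : Matrix (Fin N) (Fin N) ℂ)))).re) / (Fintype.card (Fin N) : ℝ) := by
  have h1 : ∀ p : Plaq P j, GaugeField.plaqHol (1 : GaugeField P j (SU N)) p = 1 := fun p => by
    unfold GaugeField.plaqHol
    simp only [show ∀ b : PBond P j, (1 : GaugeField P j (SU N)) b = 1 from fun _ => rfl, inv_one, mul_one]
  rw [(secondVariation_expChart_of_plaqHol_eq_one 1 X h1).deriv]
  simp only [coe_one_apply_SU, one_mul, mul_one, star_one, sub_eq_add_neg]


omit [NeZero N] in
/-- The pinned Hilbert–Schmidt norm (17) of `𝔰𝔲(N)` (`T4AdjointCovarianceUnitary.instNormedAddCommGroupLieSU`): `‖X‖² = Re Tr(X⋆X)`. [cite: Balaban1985Averaging, (17) p.21] -/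
theorem norm_sq_lieSU_eq_re_trace (X : lieSU (Fin N)) : ‖X‖ ^ 2 = (Matrix.trace (star (X : Matrix (Fin N) (Fin N) ℂ) * (X : Matrix (Fin N) (Fin N) ℂ))).re := by
  rw [← real_inner_self_eq_norm_sq]
  rfl

/-- ★ **THE FLAT VALUE AS A HILBERT–SCHMIDT SQUARE**: `d²∕dt² A(e^{tX})∣₀ = (1∕N)·Σ_p ‖X⟨x,μ⟩ + X⟨x+e_μ,ν⟩ − X⟨x+e_ν,μ⟩ − X⟨x,ν⟩‖²` in the norm (17) of `𝔰𝔲(N)` — the `∂*∂`-form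
`(1∕N)‖dX‖²` («generalizing the operator ∂*∂ in the Abelian case», [B9] p.392; the object [B16] p.357 compares with [10] (1.65)–(1.66)). [cite: Balaban1985BackgroundPropagators, (3.10) p.392; Balaban1989LargeFieldII, p.357] -/
theorem deriv_deriv_wilsonAction4_expChart_one_eq_norm_sq (X : PBond P j → lieSU (Fin N)) :
    deriv (deriv fun s : ℝ => wilsonAction4 (expChart (1 : GaugeField P j (SU N)) (s • X))) 0
      = (∑ p : Plaq P j, ‖X ⟨p.src, p.μ⟩ + X ⟨p.src.shift p.μ, p.ν⟩ - X ⟨p.src.shift p.ν, p.μ⟩ - X ⟨p.src, p.ν⟩‖ ^ 2) / (Fintype.card (Fin N) : ℝ) := by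
  rw [deriv_deriv_wilsonAction4_expChart_one]
  congr 1
  refine Finset.sum_congr rfl fun p _ => ?_
  rw [norm_sq_lieSU_eq_re_trace]
  simp only [Submodule.coe_add, Submodule.coe_sub]

end Lattice

end Literature.MathematicalPhysics.QuantumFieldTheory.Balaban1983to89.Node00

end
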